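import Summits.CriticalPhenomena.PercolationContinuityZ3.Theorems.PercNearOneGluingNoHeavyLowerTailIncStarIrreducibleTools
import Summits.CriticalPhenomena.PercolationContinuityZ3.Theorems.PercNearOneGluingNoHeavyLowerTailSahiPrincipalCycleBlocks
import HarnessLib

/-!
# Tools for the all-orders reduction: Sahi functionals of principal cluster families under restriction, no-exit and transport

Support file for the Sahi programme (`--supports stmt-CriticalPhenomena-4575`, prover prim-sahi-p2 gen 12).  No definitions, no named
facts, no sorries; standard axioms.  Memo `…/prim-sahi-p2/PROOF-E3.md` §23.

The every-order companions of `…IncStarIrreducibleTools` (which treats `E₃` of three root-connection events): for families of PRINCIPAL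
cluster events `{C_x ⊇ T_i in S} = ⋂_{t ∈ T_i} {x ↔ t in S}` and their Sahi functionals `E_k` under `bernoulliWeight w`,
* `sahiE_ind_congr_of_agree`: families of events agreeing on every configuration of positive weight have the same `E_k`;
* `sahiE_ind_congr_weight`: if all events are determined by a set `F` of pairs on which `w = w'`, then `E_k` is the same for `w`, `w'`;
* `sahiE_principal_openConn_eq_openConnIn_of_no_exit`: no pair of positive weight leaves `S ∋ x` ⇒ the family may be computed inside `S`;
* `sahiE_principal_openConnIn_of_fin`: TRANSPORT — if every principal family of every weight on `Fin m` is Sahi-positive at every order,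
  then so is every principal family inside any `m`-element vertex set of any finite weighted graph (restriction, no-exit, core pull-back
  `SahiBlobReduction.exists_coreReduce` along `Fin m ≃ S`; `|S| = 1` by the chain lemma `sahiE_indicator_nonneg_of_total`).
-/

noncomputable section

namespace Summit.CriticalPhenomena.PercolationContinuityZ3.Theorems

namespace IncStarIrreducible

open Finset MeasureTheory Literature.Combinatorics.Sahi2008 Literature.Probability.Percolation
  Literature.Probability.LatticeModels
open Literature.Probability.Percolation.DecisionTree (ind ind_of_mem ind_of_not_mem ind_nonneg)
open Literature.Probability.Percolation.BlockExploration (exists_openWalk_of_mem_openConnIn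
  mem_openConn_iff_openConnIn_univ)
open scoped Classical

variable {V : Type*}

/-- Products of indicators are indicators of intersections (plumbing). [folklore] -/
private theorem prod_ind_eq_ind_biInter' {α ι : Type*} (S : Finset ι) (A : ι → Set α) :
    ∏ i ∈ S, ind (A i) = ind (⋂ i ∈ S, A i) := by
  classical
  induction S using Finset.induction_on with
  | empty => funext a; simp [ind_of_mem]
  | insert a S ha ih =>
    rw [Finset.prod_insert ha, ih]
    funext z
    rw [Pi.mul_apply, ← BHK2006.ind_inter]
    congr 1
    ext z'
    simp

/-- Finite intersections of events determined by `F` are determined by `F` (plumbing). [folklore] -/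
private theorem determinedBy_biInter' {ι : Type*} {F : Set (Sym2 V)} (S : Finset ι) (A : ι → Set (BondConfig V))
    (h : ∀ i, DeterminedBy (A i) F) : DeterminedBy (⋂ i ∈ S, A i) F :=
  (determinedBy_iff _ _).2 fun ω ω' hωω' => by
    simp only [Set.mem_iInter]
    exact forall₂_congr fun i _ => (determinedBy_iff _ _).1 (h i) ω ω' hωω'

variable [Fintype V]

/-! ### Congruences for `E_k` of indicator families -/

/-- **Families of events that agree on every configuration of positive weight have the same Sahi functionals.** [this work] -/
theorem sahiE_ind_congr_of_agree (w : Sym2 V → unitInterval) {k : ℕ} {A B : Fin k → Set (BondConfig V)}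
    (h : ∀ ω : BondConfig V, bernoulliWeight w ω ≠ 0 → ∀ i, (ω ∈ A i ↔ ω ∈ B i)) :
    sahiE (bernoulliWeight w) k (fun i => ind (A i)) = sahiE (bernoulliWeight w) k (fun i => ind (B i)) := by
  refine TwoChainUnions.sahiE_congr_of_prodMoments (bernoulliWeight w) (bernoulliWeight w) k _ _ fun S => ?_
  rw [ex_def, ex_def]
  refine Finset.sum_congr rfl fun ω _ => ?_
  by_cases hωw : bernoulliWeight w ω = 0
  · rw [hωw, zero_mul, zero_mul]
  · congr 1
    rw [Finset.prod_apply, Finset.prod_apply]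
    refine Finset.prod_congr rfl fun i _ => ?_
    by_cases hm : ω ∈ A i
    · rw [ind_of_mem hm, ind_of_mem ((h ω hωw i).1 hm)]
    · rw [ind_of_not_mem hm, ind_of_not_mem (fun h' => hm ((h ω hωw i).2 h'))]

/-- **Locality**: if every event of the family is determined by a set `F` of pairs on which two weights agree, the Sahi functionals
agree. [this work] -/
theorem sahiE_ind_congr_weight (w w' : Sym2 V → unitInterval) {F : Set (Sym2 V)} (hpq : ∀ e ∈ F, w e = w' e) {k : ℕ}
    {A : Fin k → Set (BondConfig V)} (hA : ∀ i, DeterminedBy (A i) F) :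
    sahiE (bernoulliWeight w) k (fun i => ind (A i)) = sahiE (bernoulliWeight w') k (fun i => ind (A i)) := by
  refine TwoChainUnions.sahiE_congr_of_prodMoments (bernoulliWeight w) (bernoulliWeight w') k _ _ fun S => ?_
  have hprod : (∏ i ∈ S, fun ω => ind (A i) ω) = ind (⋂ i ∈ S, A i) := by
    rw [← prod_ind_eq_ind_biInter' S A]
  rw [hprod, ex_bernoulliWeight_ind, ex_bernoulliWeight_ind]
  exact prodBernoulli_real_eq_of_determinedBy w w' hpq (determinedBy_biInter' S A hA) MeasurableSet.of_discrete

/-- **Principal families inside `S` depend only on the off-diagonal pairs inside `S`.** [this work] -/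
theorem sahiE_principal_openConnIn_congr_weight (w w' : Sym2 V → unitInterval) (S : Set V)
    (h : ∀ e : Sym2 V, ¬ e.IsDiag → (∀ z ∈ e, z ∈ S) → w e = w' e) (x : V) (k : ℕ) (T : Fin k → Finset V) :
    sahiE (bernoulliWeight w) k (fun i => ind (⋂ t ∈ T i, (openConnIn S x t : Set (BondConfig V)))) =
      sahiE (bernoulliWeight w') k (fun i => ind (⋂ t ∈ T i, (openConnIn S x t : Set (BondConfig V)))) :=
  sahiE_ind_congr_weight w w' (F := {z : Sym2 V | ¬ z.IsDiag ∧ ∀ v ∈ z, v ∈ S}) (fun e he => h e he.1 he.2)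
    fun i => determinedBy_biInter' (T i) _ fun t => IncStarCutVertex.determinedBy_openConnIn_offDiag S x t

/-- **No exit**: if no pair of positive weight leaves `S ∋ x`, the principal families of `x` may be computed inside `S`. [this work] -/
theorem sahiE_principal_openConn_eq_openConnIn_of_no_exit (w : Sym2 V → unitInterval) (S : Set V)
    (hS : ∀ y ∈ S, ∀ z ∉ S, w s(y, z) = 0) {x : V} (hx : x ∈ S) (k : ℕ) (T : Fin k → Finset V) :
    sahiE (bernoulliWeight w) k (fun i => ind (⋂ t ∈ T i, (openConn x t : Set (BondConfig V)))) =
      sahiE (bernoulliWeight w) k (fun i => ind (⋂ t ∈ T i, (openConnIn S x t : Set (BondConfig V)))) := by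
  refine sahiE_ind_congr_of_agree w fun ω hω i => ?_
  have hN : ∀ u ∈ S, ∀ v ∉ S, s(u, v) ∉ ω := fun u hu v hv hmem =>
    hω (IncStarCycle.bernoulliWeight_eq_zero_of_mem w hmem (hS u hu v hv))
  simp only [Set.mem_iInter]
  exact forall₂_congr fun t _ => SahiBlobReduction.openConn_iff_openConnIn_of_no_exit hN hx

omit [Fintype V] in
/-- Principal events along an equality of root and targets (plumbing): if `c` maps the targets of `T'` onto those of `T`, the
pulled-back principal event is the original one. [folklore] -/
private theorem biInter_image_eq {m : ℕ} (c : Fin m → V) (x : V) (Ti : Finset V) (T'i : Finset (Fin m))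
    (h : ∀ t : V, t ∈ Ti ↔ ∃ j ∈ T'i, c j = t) :
    (⋂ j ∈ T'i, (openConn x (c j) : Set (BondConfig V))) = ⋂ t ∈ Ti, (openConn x t : Set (BondConfig V)) := by
  ext ω
  simp only [Set.mem_iInter]
  constructor
  · intro hω t ht
    obtain ⟨j, hj, rfl⟩ := (h t).1 ht
    exact hω j hj
  · intro hω j hj
    exact hω (c j) ((h (c j)).2 ⟨j, hj, rfl⟩)

/-- **Transport at every order.**  If every principal cluster family of every weight on `Fin m` is Sahi-positive at every order, then for
every finite weighted graph, every `m`-element vertex set `S`, every root `x ∈ S` and every family of target sets inside `S`, the principal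
family of `x` INSIDE `S` is Sahi-positive at every order. [this work] -/
theorem sahiE_principal_openConnIn_of_fin {m : ℕ}
    (P : ∀ (w₀ : Sym2 (Fin m) → unitInterval) (s : Fin m) (k : ℕ) (T : Fin k → Finset (Fin m)),
      0 ≤ sahiE (bernoulliWeight w₀) k (fun i => ind (⋂ t ∈ T i, (openConn s t : Set (BondConfig (Fin m))))))
    (w : Sym2 V → unitInterval) (S : Finset V) (hS : S.card = m) {x : V} (hx : x ∈ S) (k : ℕ) (T : Fin k → Finset V)
    (hT : ∀ i, ∀ t ∈ T i, t ∈ S) :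
    0 ≤ sahiE (bernoulliWeight w) k (fun i => ind (⋂ t ∈ T i, (openConnIn (↑S : Set V) x t : Set (BondConfig V)))) := by
  -- restrict the weight to the pairs inside `S`
  obtain ⟨wS, hwS⟩ : ∃ wS : Sym2 V → unitInterval, ∀ e, wS e = if ∀ z ∈ e, z ∈ S then w e else 0 :=
    ⟨_, fun e => rfl⟩
  have hagree : ∀ e : Sym2 V, ¬ e.IsDiag → (∀ z ∈ e, z ∈ (↑S : Set V)) → w e = wS e := by
    intro e _ he
    rw [hwS, if_pos (fun z hz => Finset.mem_coe.1 (he z hz))]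
  rw [sahiE_principal_openConnIn_congr_weight w wS (↑S) hagree]
  have hwS0 : ∀ y, y ∉ S → ∀ z, wS s(y, z) = 0 := fun y hy z => by
    rw [hwS, if_neg (fun hall => hy (hall y (Sym2.mem_mk_left y z)))]
  have hexit : ∀ y ∈ (↑S : Set V), ∀ z ∉ (↑S : Set V), wS s(y, z) = 0 := by
    intro y _ z hz
    rw [Sym2.eq_swap]
    exact hwS0 z (fun h => hz (Finset.mem_coe.2 h)) y
  rw [← sahiE_principal_openConn_eq_openConnIn_of_no_exit wS (↑S) hexit (Finset.mem_coe.2 hx)]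
  -- degenerate size: `S = {x}`, every event is the sure event: a chain
  rcases Nat.lt_or_ge m 2 with hm | hm
  · have hS1 : ∀ y ∈ S, y = x := by
      intro y hy
      by_contra hyx
      have hsub : ({x, y} : Finset V) ⊆ S := by
        intro z hz
        rcases Finset.mem_insert.1 hz with rfl | hz
        · exact hx
        · rw [Finset.mem_singleton] at hz; exact hz ▸ hy
      have h2 := Finset.card_le_card hsub
      rw [Finset.card_pair (Ne.symm hyx), hS] at h2
      omega
    have hE : ∀ i, (⋂ t ∈ T i, (openConn x t : Set (BondConfig V))) = Set.univ := by
      intro i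
      refine Set.eq_univ_of_forall fun ω => ?_
      simp only [Set.mem_iInter]
      intro t ht
      rw [hS1 t (hT i t ht)]
      exact SimpleGraph.Reachable.refl _
    have hind : (fun i => ind (⋂ t ∈ T i, (openConn x t : Set (BondConfig V)))) =
        fun i => (Set.univ : Set (BondConfig V)).indicator (1 : BondConfig V → ℝ) := by
      funext i ω; rw [hE i, ind_of_mem (Set.mem_univ ω), Set.indicator_of_mem (Set.mem_univ ω), Pi.one_apply]
    rw [hind]
    exact sahiE_indicator_nonneg_of_total (isFKGMeasure_bernoulliWeight wS).nonneg (sum_bernoulliWeight wS)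
      (fun _ : Fin k => (Set.univ : Set (BondConfig V))) (fun _ _ => Or.inl le_rfl)
  -- enumerate `S` and pull back to `Fin m`
  have hcard : Fintype.card (↥S) = m := by rw [Fintype.card_coe, hS]
  let e : ↥S ≃ Fin m := Fintype.equivFinOfCardEq hcard
  let c : Fin m → V := fun i => ((e.symm i : ↥S) : V)
  have hc : Function.Injective c := fun i j hij => e.symm.injective (Subtype.ext hij)
  have h01 : ((⟨0, by omega⟩ : Fin m)) ≠ ⟨1, by omega⟩ := by
    intro h; exact absurd (congrArg Fin.val h) (by norm_num)
  obtain ⟨w₀, hw₀⟩ := SahiBlobReduction.exists_coreReduce wS hc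
    (fun _ => s((⟨0, by omega⟩ : Fin m), (⟨1, by omega⟩ : Fin m)))
    (fun y _ => by rw [Sym2.mk_isDiag_iff]; exact h01)
    (fun y hy z hne => (hne (hwS0 y (fun hyS => hy ⟨e ⟨y, hyS⟩, by simp [c]⟩) z)).elim)
  have hcx : c (e ⟨x, hx⟩) = x := by simp [c]
  -- the pulled-back target sets
  let T' : Fin k → Finset (Fin m) := fun i => Finset.univ.filter fun j => c j ∈ T i
  have hTT' : ∀ i, (⋂ j ∈ T' i, (openConn (c (e ⟨x, hx⟩)) (c j) : Set (BondConfig V))) =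
      ⋂ t ∈ T i, (openConn x t : Set (BondConfig V)) := by
    intro i
    rw [hcx]
    refine biInter_image_eq c x (T i) (T' i) fun t => ⟨fun ht => ?_, ?_⟩
    · refine ⟨e ⟨t, hT i t ht⟩, ?_, by simp [c]⟩
      simp [T', c, ht]
    · rintro ⟨j, hj, rfl⟩
      simpa [T'] using hj
  have key := hw₀ (e ⟨x, hx⟩) k T'
  simp only [hTT'] at key
  rw [key]
  exact P w₀ _ k T'

end IncStarIrreducible

end Summit.CriticalPhenomena.PercolationContinuityZ3.Theorems
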